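import Summits.QuantumFields.YangMills.Theorems.BalabanUVNodesK0Stub1MultiplierO1LetterAtRecord
import HarnessLib

/-!
# K0⁷ STUB 1 (`stub_prop8StepCoP13`), sub-target S4b ♭ road — **THE `O₁` LETTER FOR THE ♭-SCALED MULTIPLIER `M♭ := λ⁻¹·(η^d(E − a))·λ⁻¹` AT UNIT BLOCK WEIGHT**,
# `λ_t = L^{j(t)}η` — the `h3132` binder of k0-s1-w2's Socket (p621022) for the multiplier that makes the Socket's `V` EQUAL print's (80) in the implicit ♭ chart
# (`Q := Qlin♭ = λ•Q_V`, `H := H♭ = H_V∘λ⁻¹`, `Dfun := Dsel♭`): [B6] Prop. 2.7 (2.149) supplies `λ_t⁻¹λ_s⁻¹` exactly at `d = 4`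
# (`η^d|M(t,s)| ≤ λ_t^{d∕2−1}λ_s^{d∕2−1}(2∕γ₀)e^{−δ₄d(t,s)}`), and Lemma 2.1 sums the row — k-UNIFORM for `d ≥ 4`

Cell `pub-ymgap`, width seat `pub-ymgap-k0-s1-w4` g2 (LOCATED-♭-MULTIPLIER-SCALING + CLAIM-4 ∕ INTENT-4, bus 2026-08-28T11:50Z).  `--kind proof --supports stmt-QuantumFields-20541 --as helper`;
count-neutral.  [15] = [Balaban1985Variational]; [B6] = [Balaban1984PropagatorsII].

WHY.  Expanding `S(e^{iηΦ(A′)})`, `Φ(A′) = A′ − H♭D♭(A′) = A′ − H_V(λ⁻¹D♭A′)`, by (26) on the slice `R∂*A′ = 0` with `(∂*∂)_V∘H_V = Qt_V∘(η^d•M_V)` (p612514) and `Q_V∘H_V = id`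
gives `S∘Φ = S(1) + ½⟨A′, ∂*∂A′⟩ + V`, `V(A′) = ½B(λ⁻¹D♭, (η^dM_V)λ⁻¹D♭) − B(Q_VA′, (η^dM_V)λ⁻¹D♭) + V₀(Φ(A′))` — print (80)∕(88) («`(QGQ*)⁻¹(Lʲη)⁻¹D(A′)`», p.291).
In the Socket's form `½B(Dfun A, MV·Dfun A) − B(QA, MV·Dfun A) + V₀(A − H(Dfun A))` with the chart's `Q = Qlin♭ = λ•Q_V` and `Dfun = Dsel♭` this is `MV = M♭ := λ⁻¹∘(η^d•M_V)∘λ⁻¹`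
(`B(λ⁻¹X, Y) = B(X, λ⁻¹Y)`), NOT `η^d•M_V`.  The Socket's `h3132` letter for `MV` is at INPUT weight 1 and OUTPUT weight `wB′`; all other ♭-road letters sit at `wB′ ≡ 1`, so
`M♭` needs `‖(M♭X)_t‖ ≤ O₁·‖X‖_∞`: a ROW SUM `Σ_s λ_t⁻¹·η^d|M(t,s)|·λ_s⁻¹` with the column factor `λ_s⁻¹` INSIDE — p616957's band letter (`wB′_t·η^dΣ_s|M(t,s)| ≤ O₁` for
`wB′_tλ_t ≤ 1`) cannot absorb it, but (2.149)'s symmetric structure `lam(t)⁻¹lam(s)⁻¹` can: `lam² = wt = λ²·L^{−jd}`, so `λ_t⁻¹η^dλ_s⁻¹lam(t)⁻¹lam(s)⁻¹ = λ_t^{d∕2−2}λ_s^{d∕2−2} ≤ 1`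
for `d ≥ 4`, and the `−a` diagonal gives `λ_t⁻²η^dws(t) = λ_t^{d−4} ≤ 1`.

WHAT IS PROVED (sorry-free; no definition; axioms standard).
* §0 `invLev_eta_invLev_invLam_le` (the two-sided length factors: `λ_t⁻¹·η^{D}·λ_s⁻¹·Λ_t⁻¹·Λ_s⁻¹ ≤ 1`, `D = e + 2`, `e ≥ 2`), `invLev_eta_invLev_band_le` (the diagonal
  `λ_t⁻¹·η^{D}·λ_t⁻¹·ws(t) ≤ 1`).
* §1 ★★ `scaledMultiplierRowSum_domT` — at every charted family (p616957's standing range), ANY auxiliary weights `w > 0`, `D = d + 1 ≥ 4`, every index bond `t`: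
  `Σ_s λ_t⁻¹·η^{D}·λ_s⁻¹·|((EE − aE w)e_s)(t)| ≤ O₁♭` (`O₁♭ = (2∕γ₀)·2D·K₂.₆₁ + 1`, a function of `d, L`).
* §2 ★★ `scaledMultiplierRowSum_of_adm22` (every `Adm22` family, level-0 chart) · §3 `scaledMultiplierRowSum_of_adm22_T4` (NODE 00's tori), ★ `scaledMultiplier_symm` (`B`-symmetry of
  `Λ⁻¹∘M∘Λ⁻¹` from that of `M`, real diagonal `Λ⁻¹`), ★★★ `h3132_scaledMultiplier_unitWeight_T4` — for every `F : T4Family`: `∃ Mh₀ R₀ O₁♭ ≥ 0` (BEFORE the family) such that at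
  every admissible family of the record's tori, ANY auxiliary weights, every normed `ℂ`-space fibre and every continuous linear `MV` with the kernel
  `λ_t⁻¹·((EE − aE w)e_s)(t)·λ_s⁻¹`: `(∀ i, 1·‖X i‖ ≤ s) → ∀ t, 1·‖((η^d•MV) X) t‖ ≤ O₁♭·s` — the Socket's `h3132` VERBATIM at `wB′ ≡ 1` for `M♭ = η^d•MV`.
HONEST SCOPE.  A replay of p616957 §1–§3 with the level factors on both sides (engines BY NAME: `FlatPortProp27PadL0.prop27_kLevel_pad`, `lemma21_torus`, `EE_sub_aE_eq_of_weights`,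
p616957's §0 lemmas); the identification of the Socket's `V` with print's `𝔊 − S(1) − ½⟨A′, ∂*∂A′⟩` is a derivation stated in the docstring (bus LOCATED-♭-MULTIPLIER-SCALING) and NOT
a theorem of this file; nothing of [15]∕[B6] asserted beyond the engines; `stub_prop8StepCoP13` ∕ K0⁷ NOT closed; N07 NOT discharged; no summit statement is proved by this seat;
counts unmoved (28∕28 · 5∕27); one finite 𝕋⁴ programme at fixed ε — R4 closes the conditional finite-𝕋⁴ rung `BalabanLadder.UV` only, never the summit; the YM mass gap (Clay) is
NOT proved by any of this; nothing continuum ∕ ℝ⁴ ∕ OS.  No `sorry`, no `def`, no `instance`, no `notation`.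

References: [B6] Prop. 2.7 (2.149) p.249, (2.142)–(2.147) p.248, (2.81) p.237, Lemma 2.1 (2.59)–(2.61) pp.233–234, (2.35) p.228, (2.16) p.225; [15] (27) p.282, (66) p.287, (80) p.290,
(87)–(88) p.291; [Balaban1983RegularityDecay] (5.7)–(5.9) pp.594–595; [Balaban1987RG1] (0.1) p.251.
-/

set_option autoImplicit false

noncomputable section

open scoped BigOperators InnerProductSpace

namespace Summit.QuantumFields.YangMills.Theorems.K0Stub1FlatMultiplierScaledO1Letter

open K0FlatPortBudgetsP (theta_budget chart_params)
open K0FlatPortKernelRowsP (unitWeights_pos globalBand_unitWeights)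
open Literature.MathematicalPhysics.QuantumFieldTheory.Balaban1983to89
open Literature.MathematicalPhysics.QuantumFieldTheory.Balaban1983to89.T4Continuum (T4Family)
open B6MultiLevelBoxOperator (N0)
open B6MultiLevelTorusOperatorL0 (TDomains)
open B6Geom246MultiLevelBoxL0 (bset)
open B6Geom246MultiLevelTorusL0 (geomT lemma21_torus)
open B6GlobalChartV1 (PV)
open B6GlobalChartV1L0 (domT)
open B6Ineq2142KLevelV1L0 (lvl lvl_le β)
open B6RandomWalk (delta3 delta3_pos)
open B6Ineq261LevelGap (K261 K261_nonneg)
open B6Ineq281MultiLevelBox (Kprof)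
open B6SectADomainsV1 (Domains)
open B6SectAOperatorsV1 (BondIdx BondIdxSpace aE)
open B6SectAVectorModelV1 (EE)
open B6Prop27KLevelV1L0 (lam lam_pos lam_sq wt aE_single rho rho_sumBound)
open B6Prop23MultiLevelTorusL0 (sumBound_torus)
open B6QGQCoerciveKLevelV1 (gam0 gam0_pos)
open FlatPortProp27PadL0 (prop27_kLevel_pad)
open Summit.QuantumFields.YangMills.Theorems.FlatCubeOpsText (Adm22)
open Summit.QuantumFields.YangMills.Theorems.K0Stub1MultiplierNormalisation (EE_sub_aE_eq_of_weights)
open Summit.QuantumFields.YangMills.Theorems.K0Stub1MultiplierO1LetterAtRecord (abs_kernel_sub_diag_le norm_kernel_smul_sum_le)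

/-! ## §0  The two-sided length factors -/

/-- **THE TWO-SIDED LENGTH FACTORS**: with `η = (Lᵏ)⁻¹`, `λ_j = Lʲη`, `j_t, j_s ≤ k`, `D = e + 2 ≥ 4` and `Λ_j² = wt_j = (Lʲ/Lᵏ)²·((L^{D})^{j})⁻¹`:
`λ_t⁻¹·η^{D}·λ_s⁻¹·Λ_t⁻¹·Λ_s⁻¹ ≤ 1` (`= λ_t^{D/2−2}·λ_s^{D/2−2}`). [cite: Balaban1984PropagatorsII, (2.142) p.248, (2.149) p.249, (2.81) p.237 (bookkeeping)] -/
theorem invLev_eta_invLev_invLam_le {Lr lt ls : ℝ} {e k jt js : ℕ} (hL : 1 ≤ Lr) (he : 2 ≤ e) (hjt : jt ≤ k) (hjs : js ≤ k) (hlt : 0 < lt) (hls : 0 < ls)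
    (hlt2 : lt ^ 2 = (Lr ^ jt / Lr ^ k) ^ 2 * ((Lr ^ (e + 2)) ^ jt)⁻¹) (hls2 : ls ^ 2 = (Lr ^ js / Lr ^ k) ^ 2 * ((Lr ^ (e + 2)) ^ js)⁻¹) :
    (Lr ^ jt * (Lr⁻¹) ^ k)⁻¹ * ((Lr⁻¹) ^ k) ^ (e + 2) * (Lr ^ js * (Lr⁻¹) ^ k)⁻¹ * lt⁻¹ * ls⁻¹ ≤ 1 := by
  have hL0 : 0 < Lr := lt_of_lt_of_le zero_lt_one hL
  have hc0 : 0 < Lr ^ k := pow_pos hL0 k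
  obtain ⟨e', rfl⟩ : ∃ e', e = e' + 2 := ⟨e - 2, by omega⟩
  -- the level ratios `x_t = L^{j_t}η`, `x_s = L^{j_s}η` lie in `(0, 1]`
  set xt : ℝ := Lr ^ jt * (Lr⁻¹) ^ k with hxt
  set xs : ℝ := Lr ^ js * (Lr⁻¹) ^ k with hxs
  have hxt0 : 0 < xt := by positivity
  have hxs0 : 0 < xs := by positivity
  have hxt1 : xt ≤ 1 := by rw [hxt, inv_pow, ← div_eq_mul_inv, div_le_one hc0]; exact pow_le_pow_right₀ hL hjt
  have hxs1 : xs ≤ 1 := by rw [hxs, inv_pow, ← div_eq_mul_inv, div_le_one hc0]; exact pow_le_pow_right₀ hL hjs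
  -- `Λ⁻² = (Lᵏ)²·(Lʲ)^{e}` and `x_j = Lʲ/Lᵏ`, so `x⁻¹·η^{e+2}·Λ⁻¹` squared is `x^{e−2}`-ish; we compute the square of the whole product
  have epow : ∀ j : ℕ, (Lr ^ (e' + 2 + 2)) ^ j = (Lr ^ j) ^ (e' + 2 + 2) := fun j => by rw [← pow_mul, ← pow_mul, mul_comm]
  have hltinv : (lt ^ 2)⁻¹ = (Lr ^ k) ^ 2 * (Lr ^ jt) ^ (e' + 2) := by rw [hlt2, epow]; field_simp; ring
  have hlsinv : (ls ^ 2)⁻¹ = (Lr ^ k) ^ 2 * (Lr ^ js) ^ (e' + 2) := by rw [hls2, epow]; field_simp; ring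
  have hηc : (Lr⁻¹) ^ k * Lr ^ k = 1 := by rw [inv_pow, inv_mul_cancel₀ hc0.ne']
  refine (sq_le_one_iff₀ (by positivity)).1 ?_
  have key : (xt⁻¹ * ((Lr⁻¹) ^ k) ^ (e' + 2 + 2) * xs⁻¹ * lt⁻¹ * ls⁻¹) ^ 2 = xt ^ e' * xs ^ e' := by
    have h1 : (xt⁻¹ * ((Lr⁻¹) ^ k) ^ (e' + 2 + 2) * xs⁻¹ * lt⁻¹ * ls⁻¹) ^ 2 =
        xt⁻¹ ^ 2 * xs⁻¹ ^ 2 * (((Lr⁻¹) ^ k) ^ (e' + 2 + 2)) ^ 2 * (lt ^ 2)⁻¹ * (ls ^ 2)⁻¹ := by ring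
    rw [h1, hltinv, hlsinv]
    have h2 : xt⁻¹ ^ 2 * xs⁻¹ ^ 2 * (((Lr⁻¹) ^ k) ^ (e' + 2 + 2)) ^ 2 * ((Lr ^ k) ^ 2 * (Lr ^ jt) ^ (e' + 2)) * ((Lr ^ k) ^ 2 * (Lr ^ js) ^ (e' + 2)) =
        xt⁻¹ ^ 2 * xs⁻¹ ^ 2 * (Lr ^ jt * (Lr⁻¹) ^ k) ^ (e' + 2) * (Lr ^ js * (Lr⁻¹) ^ k) ^ (e' + 2) * ((Lr⁻¹) ^ k * Lr ^ k) ^ 4 := by ring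
    rw [h2, hηc, one_pow, mul_one, ← hxt, ← hxs]
    field_simp
    ring
  rw [key]
  calc xt ^ e' * xs ^ e' ≤ 1 * 1 := mul_le_mul (pow_le_one₀ hxt0.le hxt1) (pow_le_one₀ hxs0.le hxs1) (by positivity) zero_le_one
    _ = 1 := one_mul 1

/-- **THE DIAGONAL AGAINST THE TWO-SIDED FACTORS**: `λ_t⁻¹·η^{D}·λ_t⁻¹·a(t) ≤ 1` for the port's band weight `a(t) = (Lᵏ/L^{j_t})²·(L^{j_t})^{D}` (`= η^{−D}λ_t^{D−2}`),
`D = e + 2 ≥ 4`, `j_t ≤ k`. [cite: Balaban1984PropagatorsII, (2.16) p.225 (bookkeeping)] -/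
theorem invLev_eta_invLev_band_le {Lr : ℝ} {e k jt : ℕ} (hL : 1 ≤ Lr) (he : 2 ≤ e) (hjt : jt ≤ k) :
    (Lr ^ jt * (Lr⁻¹) ^ k)⁻¹ * ((Lr⁻¹) ^ k) ^ (e + 2) * (Lr ^ jt * (Lr⁻¹) ^ k)⁻¹ * ((Lr ^ k / Lr ^ jt) ^ 2 * (Lr ^ jt) ^ (e + 2)) ≤ 1 := by
  have hL0 : 0 < Lr := lt_of_lt_of_le zero_lt_one hL
  have hc0 : 0 < Lr ^ k := pow_pos hL0 k
  obtain ⟨e', rfl⟩ : ∃ e', e = e' + 2 := ⟨e - 2, by omega⟩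
  set xt : ℝ := Lr ^ jt * (Lr⁻¹) ^ k with hxt
  have hxt0 : 0 < xt := by positivity
  have hxt1 : xt ≤ 1 := by rw [hxt, inv_pow, ← div_eq_mul_inv, div_le_one hc0]; exact pow_le_pow_right₀ hL hjt
  have hηc : (Lr⁻¹) ^ k * Lr ^ k = 1 := by rw [inv_pow, inv_mul_cancel₀ hc0.ne']
  have e1 : xt⁻¹ * ((Lr⁻¹) ^ k) ^ (e' + 2 + 2) * xt⁻¹ * ((Lr ^ k / Lr ^ jt) ^ 2 * (Lr ^ jt) ^ (e' + 2 + 2)) =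
      xt⁻¹ * xt⁻¹ * (Lr ^ jt * (Lr⁻¹) ^ k) ^ (e' + 2) * ((Lr⁻¹) ^ k * Lr ^ k) ^ 2 := by
    field_simp; ring
  rw [e1, hηc, one_pow, mul_one, ← hxt]
  have e2 : xt⁻¹ * xt⁻¹ * xt ^ (e' + 2) = xt ^ e' := by field_simp; ring
  rw [e2]
  exact pow_le_one₀ hxt0.le hxt1

/-! ## §1  ★★ The two-sided row sum at every charted family -/

/-- ★★ **THE ROW SUM OF `λ⁻¹·η^{D}((QGQ*)⁻¹ − a)·λ⁻¹` AT A CHARTED FAMILY** — for odd `L = ℓ + 1 ≥ 5`, `D = d + 1` with `3 ≤ d` (so `D ≥ 4`) there are `Mh₀, R₀` and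
`O₁♭ ≥ 0` (functions of `d, L`) such that in p616957's standing range, for ANY positive auxiliary weights `w` and every index bond `t`:
`Σ_s λ_t⁻¹·η^{D}·λ_s⁻¹·|((EE − aE w)e_s)(t)| ≤ O₁♭`, `λ_j = Lʲη`, `η = L^{−(K−n)}` ((2.149) at the port pad's unit band, §0, Lemma 2.1 on the torus at rate `16δ₄`, `α = 1∕16`,
the fibre count `2D`; `O₁♭ = (2∕γ₀)·2D·K₂.₆₁ + 1`). [cite: Balaban1984PropagatorsII, Prop. 2.7 (2.149) p.249, (2.142)-(2.147) p.248, Lemma 2.1 (2.59)-(2.61) pp.233-234, (2.35) p.228, (2.16) p.225; Balaban1983RegularityDecay, (5.7)-(5.9) pp.594-595] -/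
theorem scaledMultiplierRowSum_domT (d ℓ : ℕ) (hd : 1 ≤ d + 1) (hL : Odd (ℓ + 1) ∧ 1 < ℓ + 1) (hℓ : 4 ≤ ℓ) (hd3 : 3 ≤ d) :
    ∃ (Mh₀ R₀ : ℕ) (O₁ : ℝ), 0 ≤ O₁ ∧
    ∀ (m : ℕ) (n K : ℕ) {Mh R : ℕ} {P' : Fin (d + 1) → ℕ} (hN : ∀ μ, N0 ℓ Mh (K - n) P' μ = (PV d ℓ m K hd hL).sitesPerDir 0)
      (D : TDomains d ℓ Mh (K - n) P' R) (hk : K - n ≤ m + K) (_ : 1 ≤ K - n) (_ : K - n + 1 ≤ m + K)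
      {P'' : Fin (d + 1) → ℕ} (_ : ∀ μ, P' μ = (ℓ + 1) * P'' μ) (_ : ∀ μ, 5 ≤ P'' μ)
      {a : ℕ} (_ : Mh = (ℓ + 1) ^ a) (_ : Mh₀ ≤ Mh) (_ : R₀ ≤ R)
      (hcf : (((ℓ + 1 : ℕ) : ℝ)) ^ (K - n) ≠ 0) {w : BondIdx (domT hN D hk) → ℝ} (hw : ∀ i, 0 < w i)
      (t : BondIdx (domT hN D hk)),
      ∑ s, ((((ℓ + 1 : ℕ) : ℝ)) ^ (t.1.1 : ℕ) * ((((ℓ + 1 : ℕ) : ℝ))⁻¹) ^ (K - n))⁻¹ * (((((ℓ + 1 : ℕ) : ℝ))⁻¹) ^ (K - n)) ^ (d + 1) *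
          ((((ℓ + 1 : ℕ) : ℝ)) ^ (s.1.1 : ℕ) * ((((ℓ + 1 : ℕ) : ℝ))⁻¹) ^ (K - n))⁻¹ *
        |WithLp.ofLp ((EE (domT hN D hk) hcf hw - aE (domT hN D hk) w) (WithLp.toLp 2 (Pi.single s 1))) t| ≤ O₁ := by
  classical
  obtain ⟨e, rfl⟩ : ∃ e, d = e + 1 := ⟨d - 1, by omega⟩
  have he2 : 2 ≤ e := by omega
  -- [B6] Prop. 2.7 (2.149) at the unit band `b₀ = b₁ = 1` (port pad); its rate `δ₄`
  obtain ⟨σb, hσb, hB⟩ := prop27_kLevel_pad (e + 1) ℓ hd hL one_pos (le_refl (1 : ℝ))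
  obtain ⟨A', M₂b, cc, N₁b, hA', hM₂b, hcc, hrowsB⟩ := hB σb hσb le_rfl (1 / 2) (by norm_num) (by norm_num)
  set δ₃ : ℝ := delta3 (1 / 2) (2 * σb) with hδ₃
  have hδ₃0 : 0 < δ₃ := delta3_pos (by norm_num) (by linarith)
  set γ₀ : ℝ := gam0 (e + 1) ℓ 1 with hγ₀
  have hγ₀0 : 0 < γ₀ := gam0_pos (e + 1) ℓ zero_le_one
  have hCγ0 : (0 : ℝ) ≤ 2 / γ₀ := div_nonneg zero_le_two hγ₀0.le
  set δ₄ : ℝ := min (δ₃ / 4) (γ₀ / A' / (2 * (1 * (4 / δ₃) * (2 * (((e + 1 : ℕ) : ℝ) + 1) * cc)) + 1)) with hδ₄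
  have hδ₄0 : 0 < δ₄ := lt_min (by linarith) (div_pos (div_pos hγ₀0 hA') (by positivity))
  -- Lemma 2.1 budget at `(δ₀, α) = (16δ₄, 1/16)`; the constant; the thresholds
  obtain ⟨hNpos, hθ⟩ := theta_budget (e + 1) ℓ (show 0 < 1 / 16 * (16 * δ₄) by positivity)
  set Nr : ℕ := ⌈2 * ((e + 1 + 1 : ℕ) : ℝ) * Real.log ((ℓ : ℝ) + 1) / (1 / 16 * (16 * δ₄))⌉₊ + 1 with hNr
  set Lr : ℝ := (ℓ : ℝ) + 1 with hLr
  have hL1 : (1 : ℝ) ≤ Lr := by rw [hLr]; linarith [(Nat.cast_nonneg ℓ : (0 : ℝ) ≤ ℓ)]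
  set c261 : ℝ := K261 Nr (e + 1 + 1) Lr 1 (1 / 16 * (16 * δ₄)) with hc261
  have hc261_0 : 0 ≤ c261 := K261_nonneg (by linarith : (0 : ℝ) ≤ Lr) zero_le_one
  set Mh₀ : ℕ := max 8 ⌈M₂b⌉₊ with hMh₀
  set R₀ : ℕ := max (2 * (ℓ + 1) ^ 2) (max (N₁b + 1) (Nr + 1)) with hR₀
  refine ⟨Mh₀, R₀, 2 / γ₀ * (2 * (((e + 1 : ℕ) : ℝ) + 1) * c261) + 1, by positivity, ?_⟩
  intro m n K Mh R P' hN D hk hk1 hk' P'' hLP hP5 a hMha hMh hR hcf w hw t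
  have hM8 : 8 ≤ Mh := le_trans (le_max_left _ _) hMh
  have hMh1 : 1 ≤ Mh := le_trans (by norm_num) hM8
  have hR2 : 2 * (ℓ + 1) ^ 2 ≤ R := le_trans (le_max_left _ _) hR
  have hRLM : ∀ {N₁ : ℕ}, N₁ + 1 ≤ R₀ → N₁ + 1 ≤ R * ((ℓ + 1) * Mh) := fun {N₁} h =>
    le_trans (le_trans h hR) (Nat.le_mul_of_pos_right R (Nat.mul_pos (Nat.succ_pos ℓ) (by omega)))
  have hN₁b' : N₁b + 1 ≤ R * ((ℓ + 1) * Mh) := hRLM (le_trans (le_trans (le_max_left _ _) (le_max_right _ _)) le_rfl)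
  have hNr' : Nr + 1 ≤ R * ((ℓ + 1) * Mh) := hRLM (le_trans (le_trans (le_max_right _ _) (le_max_right _ _)) le_rfl)
  have hM₂b' : M₂b ≤ ((ℓ : ℝ) + 1) * Mh := by
    have h2 : (⌈M₂b⌉₊ : ℝ) ≤ (Mh : ℝ) := by exact_mod_cast le_trans (le_max_right _ _) hMh
    linarith [Nat.le_ceil M₂b, le_mul_of_one_le_left (Nat.cast_nonneg _ : (0 : ℝ) ≤ Mh) hL1]
  have hP1 : ∀ μ, 1 ≤ P' μ := fun μ => by rw [hLP μ]; exact Nat.mul_pos (Nat.succ_pos ℓ) (by have := hP5 μ; omega)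
  -- the port's band weights; (2.149) at these data
  set ws : BondIdx (domT hN D hk) → ℝ := fun i =>
    ((((ℓ + 1 : ℕ) : ℝ)) ^ (K - n) / (((ℓ + 1 : ℕ) : ℝ)) ^ (i.1.1 : ℕ)) ^ 2 * ((((ℓ + 1 : ℕ) : ℝ)) ^ (i.1.1 : ℕ)) ^ (e + 1 + 1) with hws_def
  have hws : ∀ i, 0 < ws i := unitWeights_pos (e + 1) ℓ hd hL m n K hN D hk
  have h2149 := hrowsB m K hN D hk hk1 hk' hLP hP5 hMha hM8 hR2 hℓ hM₂b' hN₁b' hcf hws (globalBand_unitWeights (e + 1) ℓ hd hL m n K hN D hk)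
  -- Lemma 2.1 on the torus and the fibre count: the row sum of the profile
  obtain ⟨-, h261, -, -⟩ := lemma21_torus (D := D) hMh1 hP1 hNpos hNr' (δ₀ := 16 * δ₄) (α := 1 / 16) (by positivity)
    (by norm_num) (by norm_num) hθ
  have hrow : ∑ s, Real.exp (-(δ₄ * rho hN D hk t s)) ≤ 2 * (((e + 1 : ℕ) : ℝ) + 1) * c261 := by
    have h : ∑ s, Real.exp (-(δ₄ * rho hN D hk t s)) ≤
        2 * (((e + 1 : ℕ) : ℝ) + 1) * Kprof (16 * δ₄) c261 (Fintype.card ↥(bset D.toDomains)) δ₄ :=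
      rho_sumBound hN D hk (sumBound_torus (D := D) hMh1 hP1 h261) δ₄ hδ₄0 t
    rwa [show Kprof (16 * δ₄) c261 (Fintype.card ↥(bset D.toDomains)) δ₄ = c261 by unfold Kprof; rw [if_pos (by linarith)]] at h
  -- canonicity: `E_w − w = E_{ws} − ws`; then the entries one by one
  rw [EE_sub_aE_eq_of_weights (domT hN D hk) hcf hw hws]
  have hLr1 : (1 : ℝ) ≤ ((ℓ + 1 : ℕ) : ℝ) := by exact_mod_cast Nat.succ_le_succ (Nat.zero_le ℓ)
  have hLr0 : (0 : ℝ) < ((ℓ + 1 : ℕ) : ℝ) := by positivity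
  -- the two-sided factor at `(t, s)`: `λ_t⁻¹·η^{D}·λ_s⁻¹ ≥ 0`
  have hfac0 : ∀ s : BondIdx (domT hN D hk), 0 ≤ ((((ℓ + 1 : ℕ) : ℝ)) ^ (t.1.1 : ℕ) * ((((ℓ + 1 : ℕ) : ℝ))⁻¹) ^ (K - n))⁻¹ *
      (((((ℓ + 1 : ℕ) : ℝ))⁻¹) ^ (K - n)) ^ (e + 1 + 1) * ((((ℓ + 1 : ℕ) : ℝ)) ^ (s.1.1 : ℕ) * ((((ℓ + 1 : ℕ) : ℝ))⁻¹) ^ (K - n))⁻¹ := fun s => by positivity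
  have hjt : (t.1.1 : ℕ) ≤ K - n := lvl_le hN D hk t
  have hent : ∀ s, ((((ℓ + 1 : ℕ) : ℝ)) ^ (t.1.1 : ℕ) * ((((ℓ + 1 : ℕ) : ℝ))⁻¹) ^ (K - n))⁻¹ * (((((ℓ + 1 : ℕ) : ℝ))⁻¹) ^ (K - n)) ^ (e + 1 + 1) *
        ((((ℓ + 1 : ℕ) : ℝ)) ^ (s.1.1 : ℕ) * ((((ℓ + 1 : ℕ) : ℝ))⁻¹) ^ (K - n))⁻¹ *
      |WithLp.ofLp ((EE (domT hN D hk) hcf hws - aE (domT hN D hk) ws) (WithLp.toLp 2 (Pi.single s 1))) t| ≤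
      2 / γ₀ * Real.exp (-(δ₄ * rho hN D hk t s)) + (if t = s then 1 else 0) := by
    intro s
    have hjs : (s.1.1 : ℕ) ≤ K - n := lvl_le hN D hk s
    -- the `E`-entry: (2.149) and the two-sided length factors
    have hfac : ((((ℓ + 1 : ℕ) : ℝ)) ^ (t.1.1 : ℕ) * ((((ℓ + 1 : ℕ) : ℝ))⁻¹) ^ (K - n))⁻¹ * (((((ℓ + 1 : ℕ) : ℝ))⁻¹) ^ (K - n)) ^ (e + 1 + 1) *
        ((((ℓ + 1 : ℕ) : ℝ)) ^ (s.1.1 : ℕ) * ((((ℓ + 1 : ℕ) : ℝ))⁻¹) ^ (K - n))⁻¹ * (lam hN D hk ((((ℓ + 1 : ℕ) : ℝ)) ^ (K - n)) t)⁻¹ *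
        (lam hN D hk ((((ℓ + 1 : ℕ) : ℝ)) ^ (K - n)) s)⁻¹ ≤ 1 :=
      invLev_eta_invLev_invLam_le (e := e) hLr1 he2 hjt hjs (lam_pos hN D hk hcf t) (lam_pos hN D hk hcf s)
        (by rw [lam_sq hN D hk hcf t]; rfl) (by rw [lam_sq hN D hk hcf s]; rfl)
    have hE : ((((ℓ + 1 : ℕ) : ℝ)) ^ (t.1.1 : ℕ) * ((((ℓ + 1 : ℕ) : ℝ))⁻¹) ^ (K - n))⁻¹ * (((((ℓ + 1 : ℕ) : ℝ))⁻¹) ^ (K - n)) ^ (e + 1 + 1) *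
        ((((ℓ + 1 : ℕ) : ℝ)) ^ (s.1.1 : ℕ) * ((((ℓ + 1 : ℕ) : ℝ))⁻¹) ^ (K - n))⁻¹ *
        |⟪EuclideanSpace.single t (1 : ℝ), EE (domT hN D hk) hcf hws (EuclideanSpace.single s (1 : ℝ))⟫_ℝ| ≤ 2 / γ₀ * Real.exp (-(δ₄ * rho hN D hk t s)) := by
      refine (mul_le_mul_of_nonneg_left (h2149 t s) (hfac0 s)).trans ?_
      calc ((((ℓ + 1 : ℕ) : ℝ)) ^ (t.1.1 : ℕ) * ((((ℓ + 1 : ℕ) : ℝ))⁻¹) ^ (K - n))⁻¹ * (((((ℓ + 1 : ℕ) : ℝ))⁻¹) ^ (K - n)) ^ (e + 1 + 1) *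
            ((((ℓ + 1 : ℕ) : ℝ)) ^ (s.1.1 : ℕ) * ((((ℓ + 1 : ℕ) : ℝ))⁻¹) ^ (K - n))⁻¹ *
            ((lam hN D hk ((((ℓ + 1 : ℕ) : ℝ)) ^ (K - n)) t)⁻¹ * (lam hN D hk ((((ℓ + 1 : ℕ) : ℝ)) ^ (K - n)) s)⁻¹ *
              (2 / γ₀ * Real.exp (-(δ₄ * (geomT D).dist (β hN D hk t) (β hN D hk s)))))
          = (((((ℓ + 1 : ℕ) : ℝ)) ^ (t.1.1 : ℕ) * ((((ℓ + 1 : ℕ) : ℝ))⁻¹) ^ (K - n))⁻¹ * (((((ℓ + 1 : ℕ) : ℝ))⁻¹) ^ (K - n)) ^ (e + 1 + 1) *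
              ((((ℓ + 1 : ℕ) : ℝ)) ^ (s.1.1 : ℕ) * ((((ℓ + 1 : ℕ) : ℝ))⁻¹) ^ (K - n))⁻¹ * (lam hN D hk ((((ℓ + 1 : ℕ) : ℝ)) ^ (K - n)) t)⁻¹ *
              (lam hN D hk ((((ℓ + 1 : ℕ) : ℝ)) ^ (K - n)) s)⁻¹) * (2 / γ₀ * Real.exp (-(δ₄ * rho hN D hk t s))) := by simp only [rho]; ring
        _ ≤ _ := (mul_le_mul_of_nonneg_right hfac (mul_nonneg hCγ0 (Real.exp_pos _).le)).trans_eq (one_mul _)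
    -- the diagonal
    have hA : ((((ℓ + 1 : ℕ) : ℝ)) ^ (t.1.1 : ℕ) * ((((ℓ + 1 : ℕ) : ℝ))⁻¹) ^ (K - n))⁻¹ * (((((ℓ + 1 : ℕ) : ℝ))⁻¹) ^ (K - n)) ^ (e + 1 + 1) *
        ((((ℓ + 1 : ℕ) : ℝ)) ^ (s.1.1 : ℕ) * ((((ℓ + 1 : ℕ) : ℝ))⁻¹) ^ (K - n))⁻¹ * (ws s * (if t = s then 1 else 0)) ≤ (if t = s then 1 else 0) := by
      by_cases hts : t = s
      · subst hts
        rw [if_pos rfl, mul_one]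
        have h := invLev_eta_invLev_band_le (Lr := (((ℓ + 1 : ℕ) : ℝ))) (e := e) (k := K - n) (jt := (t.1.1 : ℕ)) hLr1 he2 hjt
        simpa only [hws_def, mul_assoc] using h
      · rw [if_neg hts, mul_zero, mul_zero]
    calc ((((ℓ + 1 : ℕ) : ℝ)) ^ (t.1.1 : ℕ) * ((((ℓ + 1 : ℕ) : ℝ))⁻¹) ^ (K - n))⁻¹ * (((((ℓ + 1 : ℕ) : ℝ))⁻¹) ^ (K - n)) ^ (e + 1 + 1) *
          ((((ℓ + 1 : ℕ) : ℝ)) ^ (s.1.1 : ℕ) * ((((ℓ + 1 : ℕ) : ℝ))⁻¹) ^ (K - n))⁻¹ *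
          |WithLp.ofLp ((EE (domT hN D hk) hcf hws - aE (domT hN D hk) ws) (WithLp.toLp 2 (Pi.single s 1))) t|
        ≤ ((((ℓ + 1 : ℕ) : ℝ)) ^ (t.1.1 : ℕ) * ((((ℓ + 1 : ℕ) : ℝ))⁻¹) ^ (K - n))⁻¹ * (((((ℓ + 1 : ℕ) : ℝ))⁻¹) ^ (K - n)) ^ (e + 1 + 1) *
          ((((ℓ + 1 : ℕ) : ℝ)) ^ (s.1.1 : ℕ) * ((((ℓ + 1 : ℕ) : ℝ))⁻¹) ^ (K - n))⁻¹ *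
          (|⟪EuclideanSpace.single t (1 : ℝ), EE (domT hN D hk) hcf hws (EuclideanSpace.single s (1 : ℝ))⟫_ℝ| + ws s * (if t = s then 1 else 0)) :=
          mul_le_mul_of_nonneg_left (abs_kernel_sub_diag_le hN D hk hcf hws s t) (hfac0 s)
      _ = ((((ℓ + 1 : ℕ) : ℝ)) ^ (t.1.1 : ℕ) * ((((ℓ + 1 : ℕ) : ℝ))⁻¹) ^ (K - n))⁻¹ * (((((ℓ + 1 : ℕ) : ℝ))⁻¹) ^ (K - n)) ^ (e + 1 + 1) *
            ((((ℓ + 1 : ℕ) : ℝ)) ^ (s.1.1 : ℕ) * ((((ℓ + 1 : ℕ) : ℝ))⁻¹) ^ (K - n))⁻¹ *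
            |⟪EuclideanSpace.single t (1 : ℝ), EE (domT hN D hk) hcf hws (EuclideanSpace.single s (1 : ℝ))⟫_ℝ| +
          ((((ℓ + 1 : ℕ) : ℝ)) ^ (t.1.1 : ℕ) * ((((ℓ + 1 : ℕ) : ℝ))⁻¹) ^ (K - n))⁻¹ * (((((ℓ + 1 : ℕ) : ℝ))⁻¹) ^ (K - n)) ^ (e + 1 + 1) *
            ((((ℓ + 1 : ℕ) : ℝ)) ^ (s.1.1 : ℕ) * ((((ℓ + 1 : ℕ) : ℝ))⁻¹) ^ (K - n))⁻¹ * (ws s * (if t = s then 1 else 0)) := by ring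
      _ ≤ _ := add_le_add hE hA
  -- the row sum
  calc ∑ s, ((((ℓ + 1 : ℕ) : ℝ)) ^ (t.1.1 : ℕ) * ((((ℓ + 1 : ℕ) : ℝ))⁻¹) ^ (K - n))⁻¹ * (((((ℓ + 1 : ℕ) : ℝ))⁻¹) ^ (K - n)) ^ (e + 1 + 1) *
          ((((ℓ + 1 : ℕ) : ℝ)) ^ (s.1.1 : ℕ) * ((((ℓ + 1 : ℕ) : ℝ))⁻¹) ^ (K - n))⁻¹ *
        |WithLp.ofLp ((EE (domT hN D hk) hcf hws - aE (domT hN D hk) ws) (WithLp.toLp 2 (Pi.single s 1))) t|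
      ≤ ∑ s, (2 / γ₀ * Real.exp (-(δ₄ * rho hN D hk t s)) + (if t = s then 1 else 0)) := Finset.sum_le_sum fun s _ => hent s
    _ = 2 / γ₀ * ∑ s, Real.exp (-(δ₄ * rho hN D hk t s)) + 1 := by rw [Finset.sum_add_distrib, Finset.mul_sum, Finset.sum_ite_eq]; simp
    _ ≤ 2 / γ₀ * (2 * (((e + 1 : ℕ) : ℝ) + 1) * c261) + 1 := by have := mul_le_mul_of_nonneg_left hrow hCγ0; linarith

/-! ## §2  ★★ Every `Adm22` family (level-0 chart) -/

/-- ★★ **THE TWO-SIDED ROW SUM AT EVERY ADMISSIBLE FAMILY** (level-0 chart `FlatPortChartL0.tdOfAdmL0`, as p616957 §2): for odd `L = ℓ + 1 ≥ 5`, `D = d + 1 ≥ 4`,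
thresholds `Mh₀, R₀` and `O₁♭ ≥ 0` such that for every `Adm22 D R (L·M_h)` family of the standing range and ANY weights `w > 0`:
`Σ_s λ_t⁻¹·η^{D}·λ_s⁻¹·|((EE D − aE D w)e_s)(t)| ≤ O₁♭`. [cite: Balaban1984PropagatorsII, (2.1)-(2.2) p.224, Prop. 2.7 (2.149) p.249, Lemma 2.1 (2.61) p.234, (2.35) p.228] -/
theorem scaledMultiplierRowSum_of_adm22 (d ℓ : ℕ) (hd : 1 ≤ d + 1) (hL : Odd (ℓ + 1) ∧ 1 < ℓ + 1) (hℓ : 4 ≤ ℓ) (hd3 : 3 ≤ d) :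
    ∃ (Mh₀ R₀ : ℕ) (O₁ : ℝ), 0 ≤ O₁ ∧
    ∀ (m : ℕ) (n K : ℕ) (_ : 1 ≤ K - n) (_ : K - n + 1 ≤ m + K) {Mh R a' : ℕ} (_ : Mh = (ℓ + 1) ^ a') (_ : Mh₀ ≤ Mh) (_ : R₀ ≤ R)
      (_ : a' + 3 ≤ m + n) (D : Domains (PV d ℓ m K hd hL)) (hDk : D.k = K - n) (_ : Adm22 D R ((ℓ + 1) * Mh))
      (hcf : (((ℓ + 1 : ℕ) : ℝ)) ^ (K - n) ≠ 0) {w : BondIdx D → ℝ} (hw : ∀ i, 0 < w i) (t : BondIdx D),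
      ∑ s, ((((ℓ + 1 : ℕ) : ℝ)) ^ (t.1.1 : ℕ) * ((((ℓ + 1 : ℕ) : ℝ))⁻¹) ^ (K - n))⁻¹ * (((((ℓ + 1 : ℕ) : ℝ))⁻¹) ^ (K - n)) ^ (d + 1) *
          ((((ℓ + 1 : ℕ) : ℝ)) ^ (s.1.1 : ℕ) * ((((ℓ + 1 : ℕ) : ℝ))⁻¹) ^ (K - n))⁻¹ *
        |WithLp.ofLp ((EE D hcf hw - aE D w) (WithLp.toLp 2 (Pi.single s 1))) t| ≤ O₁ := by
  obtain ⟨Mh₀, R₀, O₁, hO₁, hmain⟩ := scaledMultiplierRowSum_domT d ℓ hd hL hℓ hd3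
  refine ⟨Mh₀, R₀, O₁, hO₁, ?_⟩
  intro m n K hk1 hk' Mh R a' hMha hMh hR hsize D hDk hAdm
  have hk : K - n ≤ m + K := by omega
  obtain ⟨hN, hLP, hP5⟩ := chart_params d ℓ m n K a' hd hL hℓ hk1 hsize
  rw [hMha] at hAdm
  have hN' : ∀ μ : Fin (d + 1), N0 ℓ Mh (K - n) (fun _ => 2 * (ℓ + 1) ^ (m + n - 1 - a')) μ = (PV d ℓ m K hd hL).sitesPerDir 0 := by
    rw [hMha]; exact hN
  rw [← hMha] at hAdm
  set D' := FlatPortChartL0.tdOfAdmL0 hN' D hDk hk hAdm with hD'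
  have hEq : domT hN' D' hk = D := FlatPortChartL0.domT_tdOfAdmL0 hN' D hDk hk hAdm
  rw [← hEq]
  exact hmain m n K hN' D' hk hk1 hk' hLP hP5 hMha hMh hR

/-! ## §3  NODE 00's four-tori: the `B`-symmetry of the scaled multiplier and the Socket's `h3132` at unit block weight -/

/-- **THE TWO-SIDED ROW SUM ON THE RECORD's TORI** (`T4Family.P K = PV 3 ℓ m K` by `rfl`; `D = 4`): thresholds `Mh₀, R₀` and `O₁♭ ≥ 0` (functions of `L`) such that
at every admissible family, ANY auxiliary weights `w > 0`, units `c = L^{K−n} = η⁻¹` and every index bond `t`: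
`Σ_s λ_t⁻¹·η⁴·λ_s⁻¹·|((EE D − aE D w)e_s)(t)| ≤ O₁♭`. [cite: Balaban1984PropagatorsII, Prop. 2.7 (2.149) p.249, Lemma 2.1 (2.61) p.234, (2.35) p.228; Balaban1987RG1, (0.1) p.251] -/
theorem scaledMultiplierRowSum_of_adm22_T4 (F : T4Family) :
    ∃ (Mh₀ R₀ : ℕ) (O₁ : ℝ), 0 ≤ O₁ ∧
    ∀ (n K : ℕ) (_ : 1 ≤ K - n) (_ : K - n + 1 ≤ F.m + K) {Mh R a' : ℕ} (_ : Mh = F.L ^ a') (_ : Mh₀ ≤ Mh) (_ : R₀ ≤ R)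
      (_ : a' + 3 ≤ F.m + n) (D : Domains (F.P K)) (hDk : D.k = K - n) (_ : Adm22 D R (F.L * Mh))
      (hc : ((F.P K).L : ℝ) ^ (K - n) ≠ 0) {w : BondIdx D → ℝ} (hw : ∀ i, 0 < w i) (t : BondIdx D),
      ∑ s, (((F.P K).L : ℝ) ^ (t.1.1 : ℕ) * ((((F.P K).L : ℝ))⁻¹) ^ (K - n))⁻¹ * (((((F.P K).L : ℝ))⁻¹) ^ (K - n)) ^ (F.P K).d *
          (((F.P K).L : ℝ) ^ (s.1.1 : ℕ) * ((((F.P K).L : ℝ))⁻¹) ^ (K - n))⁻¹ *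
        |WithLp.ofLp ((EE D hc hw - aE D w) (WithLp.toLp 2 (Pi.single s 1))) t| ≤ O₁ := by
  obtain ⟨L, hL, h11, m, hm⟩ := F
  obtain ⟨ℓ, rfl⟩ : ∃ ℓ, L = ℓ + 1 := ⟨L - 1, by omega⟩
  have hℓ : 4 ≤ ℓ := by omega
  obtain ⟨Mh₀, R₀, O₁, hO₁, hmain⟩ := scaledMultiplierRowSum_of_adm22 3 ℓ K0FlatCubeOpsTextP.hd4 hL hℓ le_rfl
  refine ⟨Mh₀, R₀, O₁, hO₁, ?_⟩
  intro n K hk1 hk' Mh R a' hMha hMh hR hsize D hDk hAdm hc w hw t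
  exact hmain m n K hk1 hk' hMha hMh hR hsize D hDk hAdm hc hw t

/-- ★ **`B`-SYMMETRY OF THE SCALED MULTIPLIER**: if `B X X′ = Σ_t τ(X_t X′_t)` and `M` has a real kernel `m(t,s)` with `B (M a) b = B a (M b)`, then the map with kernel
`c_t·m(t,s)·c_s` (`c` real) is `B`-symmetric too. [folklore] -/
theorem scaledMultiplier_symm {κ 𝔸 : Type*} [Fintype κ] [NormedRing 𝔸] [NormedAlgebra ℂ 𝔸]
    (τ : 𝔸 →L[ℂ] ℂ) (B : (κ → 𝔸) →L[ℂ] (κ → 𝔸) →L[ℂ] ℂ) (hB : ∀ X X' : κ → 𝔸, B X X' = ∑ t, τ (X t * X' t))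
    (mker : κ → κ → ℝ) (M : (κ → 𝔸) →L[ℂ] (κ → 𝔸)) (hM : ∀ (X : κ → 𝔸) (t : κ), M X t = ∑ s, ((mker t s : ℝ) : ℂ) • X s)
    (hMsym : ∀ a b, B (M a) b = B a (M b)) (c : κ → ℝ)
    (M' : (κ → 𝔸) →L[ℂ] (κ → 𝔸)) (hM' : ∀ (X : κ → 𝔸) (t : κ), M' X t = ∑ s, ((c t * mker t s * c s : ℝ) : ℂ) • X s)
    (a b : κ → 𝔸) : B (M' a) b = B a (M' b) := by
  -- `M′ = Λ ∘ M ∘ Λ` with `Λ X t = c_t • X t`; `B (Λ Y) b = B Y (Λ b)`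
  have hΛ : ∀ (X : κ → 𝔸), M' X = fun t => ((c t : ℝ) : ℂ) • M (fun s => ((c s : ℝ) : ℂ) • X s) t := by
    intro X; funext t
    rw [hM', hM, Finset.smul_sum]
    refine Finset.sum_congr rfl fun s _ => ?_
    rw [smul_smul, smul_smul]
    push_cast
    ring_nf
  have hBΛ : ∀ (Y b' : κ → 𝔸), B (fun t => ((c t : ℝ) : ℂ) • Y t) b' = B Y (fun t => ((c t : ℝ) : ℂ) • b' t) := by
    intro Y b'
    rw [hB, hB]
    refine Finset.sum_congr rfl fun t _ => ?_
    rw [smul_mul_assoc, mul_smul_comm]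
  rw [hΛ a, hΛ b, hBΛ, hMsym, ← hBΛ]

/-- ★★★ **THE SOCKET's `h3132` FOR THE ♭-SCALED MULTIPLIER `M♭ = η^d•(λ⁻¹(E − a)λ⁻¹)` AT UNIT BLOCK WEIGHT, k-UNIFORM** — for every `F : T4Family` there are `Mh₀, R₀` and ONE
constant `O₁♭ ≥ 0` such that at every admissible family of the record's tori in the standing range, for ANY auxiliary weights `w > 0`, units `c = L^{K−n}`, every normed `ℂ`-space
`𝔸` (e.g. `M_N(ℂ)`), every continuous linear `MV` on `BondIdx D → 𝔸` with the kernel `λ_t⁻¹·((EE D − aE D w)e_s)(t)·λ_s⁻¹` (`λ_t = L^{j(t)}η`):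
`(∀ i, 1·‖X i‖ ≤ s) → ∀ t, 1·‖((η^d•MV) X) t‖ ≤ O₁♭·s` — the binder `h3132` of `K0Stub1SectFWSlotAtRecordSocket.exists_sectF_W_atRecord_of_chartSocket` at `wB′ := fun _ => 1`,
`MV := ((η:ℂ)^d)•MV`. [cite: Balaban1984PropagatorsII, Prop. 2.7 (2.149) p.249, Lemma 2.1 (2.59)-(2.61) pp.233-234, (2.35) p.228; Balaban1985Variational, (27) p.282, (66) p.287, (80) p.290, (87)-(88) p.291; Balaban1987RG1, (0.1) p.251] -/
theorem h3132_scaledMultiplier_unitWeight_T4 (F : T4Family) :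
    ∃ (Mh₀ R₀ : ℕ) (O₁ : ℝ), 0 ≤ O₁ ∧
    ∀ (n K : ℕ) (_ : 1 ≤ K - n) (_ : K - n + 1 ≤ F.m + K) {Mh R a' : ℕ} (_ : Mh = F.L ^ a') (_ : Mh₀ ≤ Mh) (_ : R₀ ≤ R)
      (_ : a' + 3 ≤ F.m + n) (D : Domains (F.P K)) (hDk : D.k = K - n) (_ : Adm22 D R (F.L * Mh))
      (hc : ((F.P K).L : ℝ) ^ (K - n) ≠ 0) {w : BondIdx D → ℝ} (hw : ∀ i, 0 < w i)
      {𝔸 : Type*} [SeminormedAddCommGroup 𝔸] [NormedSpace ℂ 𝔸]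
      (MV : (BondIdx D → 𝔸) →L[ℂ] (BondIdx D → 𝔸))
      (_ : ∀ (X : BondIdx D → 𝔸) (t : BondIdx D),
        MV X t = ∑ s, (((((F.P K).L : ℝ) ^ (t.1.1 : ℕ) * ((((F.P K).L : ℝ))⁻¹) ^ (K - n))⁻¹ *
          WithLp.ofLp ((EE D hc hw - aE D w) (WithLp.toLp 2 (Pi.single s 1))) t *
          (((F.P K).L : ℝ) ^ (s.1.1 : ℕ) * ((((F.P K).L : ℝ))⁻¹) ^ (K - n))⁻¹ : ℝ) : ℂ) • X s)
      (X : BondIdx D → 𝔸) (s : ℝ) (_ : ∀ i, (1 : ℝ) * ‖X i‖ ≤ s) (t : BondIdx D),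
      (fun _ : BondIdx D => (1 : ℝ)) t * ‖((((((((F.P K).L : ℝ))⁻¹) ^ (K - n) : ℝ) : ℂ) ^ (F.P K).d) • MV) X t‖ ≤ O₁ * s := by
  obtain ⟨Mh₀, R₀, O₁, hO₁, hmain⟩ := scaledMultiplierRowSum_of_adm22_T4 F
  refine ⟨Mh₀, R₀, O₁, hO₁, ?_⟩
  intro n K hk1 hk' Mh R a' hMha hMh hR hsize D hDk hAdm hc w hw 𝔸 _ _ MV hMV X s hX t
  have hs : 0 ≤ s := le_trans (by rw [one_mul]; exact norm_nonneg _) (hX t)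
  have hX' : ∀ i, ‖X i‖ ≤ s := fun i => by have := hX i; rwa [one_mul] at this
  have hL0 : (0 : ℝ) < ((F.P K).L : ℝ) := by exact_mod_cast (F.P K).L_pos
  have hη0 : 0 ≤ ((((F.P K).L : ℝ))⁻¹) ^ (K - n) := by positivity
  have hrow := hmain n K hk1 hk' hMha hMh hR hsize D hDk hAdm hc hw t
  rw [one_mul, _root_.smul_apply, Pi.smul_apply, norm_smul, norm_pow, Complex.norm_real, Real.norm_eq_abs, abs_of_nonneg hη0, hMV X t]
  -- `‖Σ_s m♭(t,s)•X s‖ ≤ (Σ_s |m♭(t,s)|)·s`, and `η^d·Σ_s |m♭(t,s)| = Σ_s λ_t⁻¹η^dλ_s⁻¹|m(t,s)|`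
  have habs : ∀ s' : BondIdx D, |(((F.P K).L : ℝ) ^ (t.1.1 : ℕ) * ((((F.P K).L : ℝ))⁻¹) ^ (K - n))⁻¹ *
        WithLp.ofLp ((EE D hc hw - aE D w) (WithLp.toLp 2 (Pi.single s' 1))) t *
        (((F.P K).L : ℝ) ^ (s'.1.1 : ℕ) * ((((F.P K).L : ℝ))⁻¹) ^ (K - n))⁻¹| =
      (((F.P K).L : ℝ) ^ (t.1.1 : ℕ) * ((((F.P K).L : ℝ))⁻¹) ^ (K - n))⁻¹ *
        |WithLp.ofLp ((EE D hc hw - aE D w) (WithLp.toLp 2 (Pi.single s' 1))) t| *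
        (((F.P K).L : ℝ) ^ (s'.1.1 : ℕ) * ((((F.P K).L : ℝ))⁻¹) ^ (K - n))⁻¹ := by
    intro s'
    rw [abs_mul, abs_mul, abs_of_pos (by positivity : (0 : ℝ) < (((F.P K).L : ℝ) ^ (t.1.1 : ℕ) * ((((F.P K).L : ℝ))⁻¹) ^ (K - n))⁻¹),
      abs_of_pos (by positivity : (0 : ℝ) < (((F.P K).L : ℝ) ^ (s'.1.1 : ℕ) * ((((F.P K).L : ℝ))⁻¹) ^ (K - n))⁻¹)]
  have hsum : ((((F.P K).L : ℝ))⁻¹ ^ (K - n)) ^ (F.P K).d *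
      ∑ s', |(((F.P K).L : ℝ) ^ (t.1.1 : ℕ) * ((((F.P K).L : ℝ))⁻¹) ^ (K - n))⁻¹ *
        WithLp.ofLp ((EE D hc hw - aE D w) (WithLp.toLp 2 (Pi.single s' 1))) t *
        (((F.P K).L : ℝ) ^ (s'.1.1 : ℕ) * ((((F.P K).L : ℝ))⁻¹) ^ (K - n))⁻¹| ≤ O₁ := by
    rw [Finset.mul_sum]
    refine le_of_eq_of_le ?_ hrow
    refine Finset.sum_congr rfl fun s' _ => ?_
    rw [habs s']; ring
  calc ((((F.P K).L : ℝ))⁻¹ ^ (K - n)) ^ (F.P K).d *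
        ‖∑ s', (((((F.P K).L : ℝ) ^ (t.1.1 : ℕ) * ((((F.P K).L : ℝ))⁻¹) ^ (K - n))⁻¹ *
          WithLp.ofLp ((EE D hc hw - aE D w) (WithLp.toLp 2 (Pi.single s' 1))) t *
          (((F.P K).L : ℝ) ^ (s'.1.1 : ℕ) * ((((F.P K).L : ℝ))⁻¹) ^ (K - n))⁻¹ : ℝ) : ℂ) • X s'‖
      ≤ ((((F.P K).L : ℝ))⁻¹ ^ (K - n)) ^ (F.P K).d *
        ((∑ s', |(((F.P K).L : ℝ) ^ (t.1.1 : ℕ) * ((((F.P K).L : ℝ))⁻¹) ^ (K - n))⁻¹ *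
          WithLp.ofLp ((EE D hc hw - aE D w) (WithLp.toLp 2 (Pi.single s' 1))) t *
          (((F.P K).L : ℝ) ^ (s'.1.1 : ℕ) * ((((F.P K).L : ℝ))⁻¹) ^ (K - n))⁻¹|) * s) :=
          mul_le_mul_of_nonneg_left (norm_kernel_smul_sum_le _ X hX') (pow_nonneg hη0 _)
    _ = (((((F.P K).L : ℝ))⁻¹ ^ (K - n)) ^ (F.P K).d *
        ∑ s', |(((F.P K).L : ℝ) ^ (t.1.1 : ℕ) * ((((F.P K).L : ℝ))⁻¹) ^ (K - n))⁻¹ *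
          WithLp.ofLp ((EE D hc hw - aE D w) (WithLp.toLp 2 (Pi.single s' 1))) t *
          (((F.P K).L : ℝ) ^ (s'.1.1 : ℕ) * ((((F.P K).L : ℝ))⁻¹) ^ (K - n))⁻¹|) * s := by ring
    _ ≤ O₁ * s := mul_le_mul_of_nonneg_right hsum hs

end Summit.QuantumFields.YangMills.Theorems.K0Stub1FlatMultiplierScaledO1Letter

end
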